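import Mathlib.LinearAlgebra.Matrix.SpecialLinearGroup
import Mathlib.Data.Sign.Defs
import Mathlib.Algebra.Ring.Int.Units
import Mathlib.Data.Int.Order.Units
import Literature.NumberTheory.Automorphic.DualGroup
import Literature.NumberTheory.Automorphic.AutomorphicRepsGL
import Literature.NumberTheory.Automorphic.AutomorphicForms
import Literature.NumberTheory.Automorphic.LParameter
import Literature.NumberTheory.Automorphic.AutomorphicSpectrum
import Literature.NumberTheory.Automorphic.HilbertRepSpectrum
import Literature.NumberTheory.Automorphic.AdelicGroupData
import Literature.NumberTheory.GaloisRepresentations.WeilGroup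
import HarnessLib

-- provenance: harness21/H21/H21/Prelude/AutomorphicL/ArthurParameters.lean @ 19ed2f7 (interim HEAD d8f2665); M5 mechanical rewrite
open scoped IsMulCommutative

/-!
# Arthur parameters (trunk T-AUTOMORPHIC, G25 AutomorphicL, item I20; notion `arthur_parameters`)

Following OUTLINE D6 ("black boxes with honest combinatorics") this file provides:

* **Local A-parameters (honest).** For a non-archimedean local field `F` and a G19 L-group datum
  `L : LGroupData F` (`Ĝ = L.dual ≤ GL_N(ℂ)`, `ᴸG = Ĝ ⋊ Γ_F`), `LocalAParameter L` is a
  homomorphism `ψ : W_F × SL₂(ℂ) × SL₂(ℂ) → ᴸG` recorded through its commuting restrictions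
  `(φ, θD, θA)` with the G19 `LParameter` conditions on `(φ, θD)`, algebraicity of `θA`
  (G19 `IsPolynomialHom`) and boundedness of `φ(W_F)` (Arthur 1989 §4; Arthur 2013 §1.3).
  API: `toLParameter`, `ofBounded`, `sl2Diag : ℂˣ →* SL₂(ℂ)`, `sqrtNormUnit w = ‖w‖^{1/2}`
  (G09 `WeilGroup.norm`), the predicate `IsLParameterOf ψ φ'` (`φ_ψ(w) = ψ(w, diag(‖w‖^{1/2},
  ‖w‖^{-1/2}))`, Arthur 2013 (1.3.3)) with the uniqueness `IsLParameterOf.unique`, the case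
  `isLParameterOf_ofBounded` and the NAMED FACT `exists_isLParameterOf : Prop` (existence of
  `φ_ψ`, Arthur 1989 §4; stated, not asserted), the centralizer
  `sGroupA = S_ψ`, Arthur's quotient `componentGroupA = 𝒮_ψ = S_ψ / S_ψ° Z(Ĝ)^Γ` and the element
  `sPsi = s_ψ` (image of `θA(-1)`), with `sPsi_sq`.
* **Formal global parameters for `GL_N` (honest, Arthur 2013 §1.4).**
  `FormalGlobalParameterGL K hcpt N` (`ψ = ⊞ μ_i ⊠ ν_{d_i}`,
  `μ_i : CuspidalAutomorphicRepData (m i) K (hcpt (m i))` from I15, `∑ m_i d_i = N`),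
  `IsMultiplicityFree` (Arthur (1.4.1): the pairs `(μ_i, d_i)` are distinct, phrased with I15's
  `IsNearlyEquivalent` transported along `m i = m j`), the hypothesis-structures
  `SelfDualTypeData K hcpt` (orthogonal / symplectic / not self-dual, a `SignType`) and
  `RSRootNumberData K hcpt` (`ε(1/2, μ × μ') ∈ ℤˣ`), the enumeration `ClassicalType` of Arthur's groups
  `Sp(2n)`, `SO(2n+1)`, `SO(2n)` with `dualDim`, `dualSign`, the predicate `IsEllipticFor sd G ψ`
  (`ψ ∈ Ψ̃₂(G)`), the formal group `sGroupFormal ψ = (ℤˣ)^ι` and Arthur's sign character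
  `epsCharacter sd rn ψ : sGroupFormal ψ →* ℤˣ` (Arthur 2013 (1.5.6), a genuine `MonoidHom`).
* **Packets and the multiplicity formula (hypothesis-structure).** `ArthurPacketData 𝒢 μ Ψ S`
  (packets of G19 `DiscreteAutomorphicRep`s, pairing `⟨x, π⟩`, sign characters `ε_ψ`, finiteness),
  `arthurMultiplicity data ψ π = |𝒮_ψ|⁻¹ ∑_x ε_ψ(x) ⟨x, π⟩` and the UNTAGGED
  `ArthurMultiplicityStatement data` (Arthur 1989 §8, Conj. 8.1; Arthur 2013 Thm. 1.5.2),
  comparing G19's `multiplicity (rightRegular 𝒢 μ) π` (an `ℕ∞`) with the complex sum through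
  `∃ m : ℕ` (review 14).

## Mathlib search

Mathlib (this pin) has `Matrix.SpecialLinearGroup` with the diagonal element
`Matrix.SpecialLinearGroup.diag2 a ha : SL(2, F)` (+ `diag2_coe'`, `diag2_inv`), which we USE:
only the bundling `sl2Diag : ℂˣ →* SL(2, ℂ)` as a `MonoidHom` is new. It has `SignType`, `ℤˣ` with `Int.units_eq_one_or` / `Int.units_mul_self`,
`Pi.evalMonoidHom`, `MonoidHom.finsetProd_apply`, `Subgroup.centralizer`,
`Subgroup.connectedComponentOfOne`, `Subgroup.sup_normal`, `QuotientGroup`; it has no Weil groups,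
L-parameters, A-parameters, automorphic representations or Arthur packets (grep `Arthur`, `AParameter`,
`packet`: nothing). Nothing here duplicates a Mathlib declaration. All H21 notions used are the
accepted ones: G19 `LGroupData`, `LParameter`, `IsPolynomialHom`, `LGroupData.centerFixed`,
`DiscreteAutomorphicRep`, `AdelicGroupData.rightRegular`, `ContRepresentation.multiplicity`;
G09 `WeilGroup`, `WeilGroup.norm`; I15 `CuspidalAutomorphicRepData`,
`AutomorphicRepData.IsNearlyEquivalent`.

## Design notes

* (H1) `attribute [local instance 100] LieRing.ofAssociativeRing`; (H2) `open scoped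
  IsMulCommutative` right after the imports. The imports `DualGroup`, `AutomorphicForms`,
  `HilbertRepSpectrum` are the item's declared dependency list (`DualGroupStr` hygiene); no
  declaration of `DualGroup` is used directly in this file.
* `componentGroupA` is Arthur's `𝒮_ψ = S_ψ / S_ψ° Z(Ĝ)^Γ` (not merely `π₀(S_ψ)` as G19's
  `LParameter.componentGroup`): the kernel `sGroupAKer = S_ψ° ⊔ (Z(Ĝ)^Γ ⊓ S_ψ)` is normal by
  G19 `connectedComponentOfOne_normal`, the (proved) instance `LGroupData.centerFixed_normal`
  (`Z(Ĝ)^Γ ⊴ Ĝ`, transported by Mathlib `Subgroup.normal_subgroupOf`) and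
  Mathlib `Subgroup.sup_normal`; the `Group` instance on the quotient is pinned explicitly
  (`QuotientGroup.Quotient.group`) because unguided instance search on the raw quotient times out.
* `epsCharacter` takes the self-duality data `sd` as well as `rn` (the outline's `epsCharacter rn ψ`):
  Arthur's product (1.5.6) runs over constituents with `μ_α = μ_k × μ_l` *symplectic*, i.e. `μ_k`,
  `μ_l` of opposite types, which only `sd` can express without baking in Arthur's Thm. 1.5.3 (b)
  (`ε(1/2) = 1` for orthogonal pairs). Each unordered opposite-type pair is counted once, at its
  symplectic member, so no order on `ι` is needed.
* Junk values (documented at the declarations): `RSRootNumberData.ε` is unconstrained on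
  non-self-dual pairs (only `epsCharacter`'s use is guarded by `sd`);
  `ArthurPacketData.pairing ψ π = 0` for `π ∉ Π_ψ` (so `m_ψ(π) = 0` there,
  `arthurMultiplicity_eq_zero`). `IsEllipticFor` writes `(-1)^(d_i + 1)` for `(-1)^(d_i - 1)`
  (no `ℕ`-subtraction) and omits the central-character condition (no central characters of
  `CuspidalAutomorphicRepData` in H21). `ClassicalType.evenOrthogonal` does not record the outer
  twist `η`. `FormalGlobalParameterGL` does not impose unitarity of `μ_i` (not expressible on the
  I15 datum); Arthur's `Ψ(N)` assumes it.
* Universe discipline (H9): `FormalGlobalParameterGL.ι : Type`, `componentGroupA : Type`,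
  `K : Type` as in G19/I15.

## M5 migration note (D-0014: `Literature/` is sorry-free)

* The formerly sorried theorem `LocalAParameter.exists_isLParameterOf` (existence of `φ_ψ`,
  Arthur 1989 §4 / Arthur 2013 (1.3.3); neither source is held) is now the NAMED FACT
  `def LocalAParameter.exists_isLParameterOf (ψ) : Prop` (same name, same statement), consumed as a
  hypothesis `(h : ψ.exists_isLParameterOf)` (e.g. `existsUnique_isLParameterOf h`); nothing in the
  tree used the theorem as a term.  Proved API around it: `isLParameterOf_iff`,
  `IsLParameterOf.unique`, `isLParameterOf_ofBounded`, `exists_isLParameterOf_ofBounded` (the fact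
  holds for generic parameters), `existsUnique_isLParameterOf`.
* I15's `CuspidalAutomorphicRepData m K hcpt` now takes the I13 named fact
  `hcpt : isCompact_glFiniteIntegralLevel m K`; since a formal parameter mixes all ranks `m_i`, the
  global section takes `hcpt : ∀ n, isCompact_glFiniteIntegralLevel n K` and threads it explicitly
  through `FormalGlobalParameterGL K hcpt N`, `SelfDualTypeData K hcpt`, `RSRootNumberData K hcpt`,
  and implicitly (`{hcpt}`, read off the types) through `IsMultiplicityFree`, `IsEllipticFor`,
  `sGroupFormal`, `epsCharacter`.  `ArthurPacketData` and the multiplicity formula do not use it.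

## Fact audit (2026-08-15): `IsMultiplicityFree` is a predicate, not a named fact

`FormalGlobalParameterGL.IsMultiplicityFree ψ` is Arthur's CONDITION "`ℓ_k = 1` for all `k`" on a
formal parameter `ψ = ℓ₁ψ₁ ⊞ ⋯ ⊞ ℓ_rψ_r ∈ Ψ(N)` (Arthur 2013, (1.4.1): the multiplicities `ℓ_k ≥ 1`
are arbitrary in `Ψ(N)`; the condition cuts out `Ψ_ell(N) ⊃ Ψ̃₂(G)`; same in the held account Mok,
Mem. AMS 235 (2015), (2.3.3) and the definition of `Ψ̃_ell(N)`, arXiv:1206.0882 pp. 10–11).  It is a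
definition with a body, used as such by `IsEllipticFor`; there is no closed statement
`IsMultiplicityFree` to discharge, and its universal closure is false: the proved
`FormalGlobalParameterGL.not_forall_isMultiplicityFree` exhibits `2(μ ⊠ ν₁) = μ ⊞ μ ∈ Ψ(2n)`, which
is not multiplicity free, for any cuspidal `μ` on `GL_n` that is unramified almost everywhere
(the I15 named fact `AutomorphicRepData.hasSatakeParamAt_cofinite μ.1`, which makes `μ` nearly
equivalent to itself).  Since 2026-08-15 the argument `ψ` is an explicit binder of the definition
(previously supplied by a `variable` line, which made the declaration read textually as a closed
`def … : Prop`); the elaborated declarations `IsMultiplicityFree` and `pos_of_nonempty` are unchanged.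

## References

* J. Arthur, *Unipotent automorphic representations: conjectures*, Astérisque 171–172 (1989),
  §4 (parameters `ψ`, `S_ψ`, `𝒮_ψ`, `s_ψ`, `φ_ψ`), §8 (`ε_ψ`, the multiplicity formula, Conj. 8.1).
* J. Arthur, *The endoscopic classification of representations: orthogonal and symplectic
  groups*, AMS Colloquium Publ. 61 (2013), §1.3 (`ψ`, `φ_ψ`, (1.3.3)), §1.4 (`Ψ̃₂(G)`, (1.4.1),
  (1.4.8)–(1.4.10)), §1.5 (Thm. 1.5.2, Thm. 1.5.3, (1.5.5)–(1.5.7)).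
* J. Tate, *Number theoretic background*, Corvallis 1979, (1.4.6) (`‖w‖`).
* C. P. Mok, *Endoscopic classification of representations of quasi-split unitary groups*,
  Mem. AMS 235 (2015), no. 1108, §2.3, (2.3.3) (formal parameters `l₁ψ₁ ⊞ ⋯ ⊞ l_rψ_r`, `Ψ̃_ell(N)`:
  `l_i = 1`); arXiv:1206.0882, pp. 10–11 (held).
-/

-- Mathlib idiom (Mathlib/Algebra/Lie/OfAssociative.lean); needed to mention Lie subalgebras of matrix algebras
attribute [local instance 100] LieRing.ofAssociativeRing

noncomputable section

open Matrix MeasureTheory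
open scoped MatrixGroups

namespace Literature.NumberTheory.Automorphic

/-! ### The diagonal torus of `SL₂` -/

/-- The diagonal cocharacter `a ↦ diag(a, a⁻¹) : 𝔾ₘ → SL₂` as a `MonoidHom ℂˣ →* SL(2, ℂ)`,
built on Mathlib's `Matrix.SpecialLinearGroup.diag2` (which provides the element `diag(a, a⁻¹)`
but not the bundled homomorphism). Used to form
`diag(‖w‖^{1/2}, ‖w‖^{-1/2})` and `-1 = diag(-1, -1)`.
Ref: Arthur, *Unipotent automorphic representations: conjectures*, Astérisque 171–172 (1989),
§4, (4.2); Arthur, *The endoscopic classification of representations* (2013), §1.3, (1.3.3). [folklore] -/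
def sl2Diag : ℂˣ →* SL(2, ℂ) where
  toFun a := Matrix.SpecialLinearGroup.diag2 (a : ℂ) a.ne_zero
  map_one' := by
    ext i j
    fin_cases i <;> fin_cases j <;> simp [Matrix.SpecialLinearGroup.diag2_coe']
  map_mul' a b := by
    ext i j
    fin_cases i <;> fin_cases j <;>
      simp [Matrix.SpecialLinearGroup.diag2_coe', Matrix.mul_apply, Fin.sum_univ_two, mul_comm]

/-- Entries of `sl2Diag a`.  Ref: Arthur (2013), (1.3.3). [cite: Arthur2013] -/
@[simp] theorem coe_sl2Diag (a : ℂˣ) :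
    ((sl2Diag a : SL(2, ℂ)) : Matrix (Fin 2) (Fin 2) ℂ) = !![(a : ℂ), 0; 0, ((a⁻¹ : ℂˣ) : ℂ)] := by
  rw [show (sl2Diag a : SL(2, ℂ)) = Matrix.SpecialLinearGroup.diag2 (a : ℂ) a.ne_zero from rfl,
    Matrix.SpecialLinearGroup.diag2_coe', Units.val_inv_eq_inv_val]

/-! ### Local A-parameters -/

section Local

variable {F : Type*} [Field F] [ValuativeRel F] [TopologicalSpace F] [IsNonarchimedeanLocalField F]

/-- `Z(Ĝ)^Γ` is normal in `Ĝ` (it is central); with Mathlib's instance `Subgroup.normal_subgroupOf`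
this makes `Z(Ĝ)^Γ ∩ H` normal in every `H ≤ Ĝ`. (An instance on the H21 subgroup
`LGroupData.centerFixed`; no Mathlib instance is overridden.)
Ref: Kottwitz, *Stable trace formula: cuspidal tempered terms*, Duke Math. J. 51 (1984), §1. [folklore] -/
instance LGroupData.centerFixed_normal (L : LGroupData F) : L.centerFixed.Normal where
  conj_mem n hn g := by
    have hc : g * n = n * g := Subgroup.mem_center_iff.mp hn.1 g
    rwa [hc, mul_inv_cancel_right]

/-- A **local A-parameter** (Arthur parameter) for the L-group datum `L` over the
non-archimedean local field `F`: a homomorphism `ψ : W_F × SL₂(ℂ) × SL₂(ℂ) → ᴸG = Ĝ ⋊ Γ_F`,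
recorded as its three commuting restrictions `φ = ψ|_{W_F}`, `θD = ψ|_{SL₂}` (Deligne's `SL₂`)
and `θA = ψ|_{SL₂}` (Arthur's `SL₂`), such that `(φ, θD)` is an L-parameter in the sense of G19
(`rightHom_φ`, continuity `exists_isOpen`, Frobenius-semisimplicity, algebraicity of `θD`), `θA`
is algebraic, and the restriction to `W_F` is **bounded** (`φ(W_F)` has relatively compact
image in `Ĝ`), i.e. `ψ|_{L_F}` is tempered.
Ref: Arthur, *Unipotent automorphic representations: conjectures*, Astérisque 171–172 (1989),
§4; Arthur, *The endoscopic classification of representations* (2013), §1.3. [folklore] -/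
structure LocalAParameter (L : LGroupData F) where
  /-- The restriction `W_F → ᴸG`. -/
  φ : GaloisRepresentations.WeilGroup F →* L.LGroup
  /-- The restriction to Deligne's `SL₂(ℂ)` (monodromy). -/
  θD : SL(2, ℂ) →* L.dual
  /-- The restriction to Arthur's `SL₂(ℂ)`. -/
  θA : SL(2, ℂ) →* L.dual
  /-- `φ` lies over the inclusion `W_F → Γ_F`. -/
  rightHom_φ : ∀ w, (φ w).right = GaloisRepresentations.WeilGroup.toAbsGalois F w
  /-- Continuity: `φ` is the canonical section on an open subgroup of inertia. -/
  exists_isOpen : ∃ U : Subgroup (GaloisRepresentations.WeilGroup F), U ≤ GaloisRepresentations.WeilGroup.inertia F ∧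
    IsOpen (U : Set (GaloisRepresentations.WeilGroup F)) ∧
      ∀ u ∈ U, φ u = SemidirectProduct.inr (GaloisRepresentations.WeilGroup.toAbsGalois F u)
  /-- `θD` is a morphism of algebraic groups. -/
  isPolynomial_θD : IsPolynomialHom θD
  /-- `θA` is a morphism of algebraic groups. -/
  isPolynomial_θA : IsPolynomialHom θA
  /-- The two `SL₂`'s commute. -/
  commute_θ : ∀ s t, θD s * θA t = θA t * θD s
  /-- `φ(W_F)` commutes with Deligne's `SL₂`. -/
  commute_φ_θD : ∀ w s, φ w * SemidirectProduct.inl (θD s) = SemidirectProduct.inl (θD s) * φ w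
  /-- `φ(W_F)` commutes with Arthur's `SL₂`. -/
  commute_φ_θA : ∀ w s, φ w * SemidirectProduct.inl (θA s) = SemidirectProduct.inl (θA s) * φ w
  /-- Frobenius-semisimplicity of `φ` (as in G19 `LParameter`). -/
  frobSemisimple : ∀ (w : GaloisRepresentations.WeilGroup F) (m : ℕ), 0 < m → L.galAct ((φ w) ^ m).right = 1 →
    Module.End.IsSemisimple
      (Matrix.toLin' ((((φ w) ^ m).left : GL (Fin L.rank) ℂ) : Matrix (Fin L.rank) (Fin L.rank) ℂ))
  /-- Boundedness: the projection of `φ(W_F)` to `Ĝ ≤ GL_N(ℂ)` is relatively compact. -/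
  bounded : IsCompact (closure (Set.range fun w : GaloisRepresentations.WeilGroup F => ((φ w).left : GL (Fin L.rank) ℂ)))

namespace LocalAParameter

variable {L : LGroupData F} (ψ : LocalAParameter L)

/-- The (bounded) L-parameter `(φ, θD) = ψ|_{W_F × SL₂}` underlying an A-parameter (forgetting
Arthur's `SL₂`).  Ref: Arthur (1989), §4; Arthur (2013), §1.3. [cite: Arthur1989] -/
def toLParameter : LParameter L where
  φ := ψ.φ
  θ := ψ.θD
  rightHom_φ := ψ.rightHom_φ
  comm := ψ.commute_φ_θD
  exists_isOpen := ψ.exists_isOpen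
  isPolynomial_θ := ψ.isPolynomial_θD
  frobSemisimple := ψ.frobSemisimple

/-- `ψ|_{W_F × SL₂}` is bounded (tempered), by the field `bounded`.  Ref: Arthur (1989), §4. [cite: Arthur1989] -/
theorem isBounded_toLParameter : ψ.toLParameter.IsBounded := ψ.bounded

/-- A **bounded (tempered) L-parameter is an A-parameter** with trivial Arthur `SL₂`
(`θA = 1`); these are the *generic* A-parameters.
Ref: Arthur (1989), §4 (tempered parameters `φ` give `ψ = (φ, 1)`); Arthur (2013), §1.3. [cite: Arthur1989] -/
def ofBounded (φ : LParameter L) (hφ : φ.IsBounded) : LocalAParameter L where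
  φ := φ.φ
  θD := φ.θ
  θA := 1
  rightHom_φ := φ.rightHom_φ
  exists_isOpen := φ.exists_isOpen
  isPolynomial_θD := φ.isPolynomial_θ
  isPolynomial_θA := IsPolynomialHom.one
  commute_θ s t := by simp
  commute_φ_θD := φ.comm
  commute_φ_θA w s := by simp
  frobSemisimple := φ.frobSemisimple
  bounded := hφ

/-- The L-parameter underlying `ofBounded φ hφ` is `φ`.  Ref: Arthur (1989), §4. [cite: Arthur1989] -/
@[simp] theorem toLParameter_ofBounded (φ : LParameter L) (hφ : φ.IsBounded) :
    (ofBounded φ hφ).toLParameter = φ := rfl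

/-- The unit `‖w‖^{1/2} ∈ ℂˣ` for `w ∈ W_F` (`WeilGroup.norm w = q ^ deg w > 0`, G09).
Ref: Tate, *Number theoretic background* (Corvallis 1979), (1.4.6); Arthur (2013), (1.3.3). [cite: Corvallis1979] -/
def sqrtNormUnit (w : GaloisRepresentations.WeilGroup F) : ℂˣ :=
  Units.mk0 ((Real.sqrt (GaloisRepresentations.WeilGroup.norm w) : ℝ) : ℂ)
    (Complex.ofReal_ne_zero.2 (Real.sqrt_pos.2 (GaloisRepresentations.WeilGroup.norm_pos w)).ne')

/-- The L-parameter `φ'` **is the L-parameter `φ_ψ` attached to** the A-parameter `ψ`: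
`φ'(w) = ψ(w, diag(‖w‖^{1/2}, ‖w‖^{-1/2}))`, i.e. `φ'.φ w = ψ.φ w · θA(diag(‖w‖^{1/2}, ‖w‖^{-1/2}))`
in `ᴸG`, and `φ'` has the same Deligne `SL₂` as `ψ`.
Ref: Arthur (1989), §4, (4.2); Arthur (2013), §1.3, (1.3.3)–(1.3.4). [cite: Arthur1989] -/
def IsLParameterOf (φ' : LParameter L) : Prop :=
  (∀ w, φ'.φ w = ψ.φ w * SemidirectProduct.inl (ψ.θA (sl2Diag (sqrtNormUnit w)))) ∧
    φ'.θ = ψ.θD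

/-- Unfolding of `IsLParameterOf`.  Ref: Arthur (1989), §4, (4.2). [cite: Arthur1989] -/
theorem isLParameterOf_iff (φ' : LParameter L) :
    ψ.IsLParameterOf φ' ↔
      (∀ w, φ'.φ w = ψ.φ w * SemidirectProduct.inl (ψ.θA (sl2Diag (sqrtNormUnit w)))) ∧
        φ'.θ = ψ.θD :=
  Iff.rfl

/-- **`φ_ψ` is unique**: an L-parameter is determined by its data `(φ, θ)`, and both are pinned by
`IsLParameterOf`.  Ref: Arthur (1989), §4, (4.2); Arthur (2013), (1.3.3). [cite: Arthur1989] -/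
theorem IsLParameterOf.unique {φ' φ'' : LParameter L} (h' : ψ.IsLParameterOf φ')
    (h'' : ψ.IsLParameterOf φ'') : φ' = φ'' := by
  obtain ⟨hφ', hθ'⟩ := h'
  obtain ⟨hφ'', hθ''⟩ := h''
  cases φ' with
  | mk φ₁ θ₁ _ _ _ _ _ =>
    cases φ'' with
    | mk φ₂ θ₂ _ _ _ _ _ =>
      have hφ : φ₁ = φ₂ := MonoidHom.ext fun w => (hφ' w).trans (hφ'' w).symm
      have hθ : θ₁ = θ₂ := hθ'.trans hθ''.symm
      subst hφ hθ
      rfl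

/-- For a **generic** A-parameter `ofBounded φ hφ` (trivial Arthur `SL₂`), `φ_ψ = φ`.
Ref: Arthur (1989), §4 (tempered `φ` give `ψ = (φ, 1)` with `φ_ψ = φ`); Arthur (2013), §1.3. [cite: Arthur1989] -/
theorem isLParameterOf_ofBounded (φ : LParameter L) (hφ : φ.IsBounded) :
    (ofBounded φ hφ).IsLParameterOf φ :=
  ⟨fun w => by simp [ofBounded], rfl⟩

/-- NAMED FACT (statement only; discharged in the sibling file `ArthurParametersProofs` as
`exists_isLParameterOf_holds`). **Every A-parameter has an L-parameter `φ_ψ`**: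
the recipe `w ↦ ψ(w, diag(‖w‖^{1/2}, ‖w‖^{-1/2}))` (Arthur 1989, §4, pp. 25–26, and §6, p. 38;
Arthur 2013, §1.3) defines an L-parameter `φ_ψ ∈ Φ(G)` — a homomorphism because `w ↦ ‖w‖` is a
(continuous) character of `W_F`, continuous because `‖·‖ = 1` on inertia, Frobenius-semisimple
because `θA(diag(t, t⁻¹))` is semisimple (image of a semisimple element under the algebraic
`θA`) and commutes with `φ(W_F)`.  In this encoding the proof goes through G09
`WeilGroup.norm_mul` / `norm_eq_one_iff_mem_inertia` (fed with the discharged G09 facts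
`IsFrobPow.mul_holds`, `IsFrobPow.unique_holds`) and preservation of semisimplicity under
`IsPolynomialHom`s on the diagonal torus; it lives in the sibling proof file to keep this file's
imports unchanged, so the statement stays a `Prop` here (users take
`(h : ψ.exists_isLParameterOf)` and feed it `exists_isLParameterOf_holds`).  It holds for generic
parameters by `exists_isLParameterOf_ofBounded`, and the witness is unique
(`IsLParameterOf.unique`).
Ref: Arthur, *Unipotent automorphic representations: conjectures*, Astérisque 171–172 (1989),
13–71: §4, pp. 25–26 — "For each `ψ ∈ Ψ(G)`, we define a parameter `φ_ψ ∈ Φ(G*)` by setting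
`φ_ψ(w)` equal to the image of `ψ(w, diag(|w|^{1/2}, |w|^{-1/2}))`, `w ∈ W_ℝ`, in `ᴸG*`"
(`F = ℝ`), and §6, p. 38 — "Suppose that `ψ ∈ Ψ(G)`. Then the restriction of `ψ` to `L_F`
belongs to `Φ_temp(G*)`. Similarly, as in §4, we can define the objects `φ_ψ ∈ Φ(G*)` and
`s_ψ`" (any local `F`; the labels (4.2)–(4.3) quoted in earlier revisions of this docstring are
character identities in that paper, not this definition); Arthur, *The endoscopic
classification of representations* (2013), §1.3; secondary source with the same recipe "we
define the L-parameter `φ_ψ ∈ Φ(G)` associated to `ψ` by the formula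
`φ_ψ(σ) = ψ(σ, diag(|σ|^{1/2}, |σ|^{-1/2}))`": Mok, *Endoscopic classification of
representations of quasi-split unitary groups*, Mem. AMS 235 (2015), no. 1108, (2.2.11)
(arXiv:1206.0882, p. 10). [cite: Arthur1989, §4 pp. 25–26, §6 p. 38] -/
def exists_isLParameterOf : Prop :=
  ∃ φ' : LParameter L, ψ.IsLParameterOf φ'

/-- Unfolding of the named fact `exists_isLParameterOf`.  Ref: Arthur (1989), §4. [cite: Arthur1989] -/
theorem exists_isLParameterOf_iff :
    ψ.exists_isLParameterOf ↔ ∃ φ' : LParameter L, ψ.IsLParameterOf φ' :=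
  Iff.rfl

/-- The named fact `exists_isLParameterOf` **holds for generic A-parameters** `(φ, 1)`, with
witness `φ_ψ = φ`.  Ref: Arthur (1989), §4; Arthur (2013), §1.3. [cite: Arthur1989] -/
theorem exists_isLParameterOf_ofBounded (φ : LParameter L) (hφ : φ.IsBounded) :
    (ofBounded φ hφ).exists_isLParameterOf :=
  ⟨φ, isLParameterOf_ofBounded φ hφ⟩

/-- Under the named fact, `φ_ψ` **exists uniquely**.  Ref: Arthur (1989), §4, (4.2). [cite: Arthur1989] -/
theorem existsUnique_isLParameterOf (h : ψ.exists_isLParameterOf) :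
    ∃! φ' : LParameter L, ψ.IsLParameterOf φ' := by
  obtain ⟨φ', hφ'⟩ := h
  exact ⟨φ', hφ', fun φ'' hφ'' => IsLParameterOf.unique ψ hφ'' hφ'⟩

/-- The **centralizer** `S_ψ = Cent(im ψ, Ĝ)`: elements of `Ĝ` commuting with `φ(W_F)`, `θD(SL₂)`
and `θA(SL₂)` (G19 `LParameter.centralizerGroup` of `(φ, θD)` intersected with the Mathlib
`Subgroup.centralizer` of the image of `θA`).
Ref: Arthur (1989), §4 (`S_ψ`); Arthur (2013), §1.4 (before (1.4.8)). [cite: Arthur1989] -/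
def sGroupA : Subgroup L.dual :=
  ψ.toLParameter.centralizerGroup ⊓ Subgroup.centralizer (Set.range ψ.θA)

/-- Membership in `S_ψ`.  Ref: Arthur (1989), §4. [cite: Arthur1989] -/
theorem mem_sGroupA_iff (g : L.dual) :
    g ∈ ψ.sGroupA ↔ g ∈ ψ.toLParameter.centralizerGroup ∧ ∀ s, ψ.θA s * g = g * ψ.θA s := by
  simp only [sGroupA, Subgroup.mem_inf, Subgroup.mem_centralizer_iff, Set.forall_mem_range]

/-- The subgroup `S_ψ° · (Z(Ĝ)^Γ ∩ S_ψ) ≤ S_ψ` by which Arthur divides: `S_ψ°` is the identity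
component of `S_ψ ≤ GL_N(ℂ)` (Mathlib `Subgroup.connectedComponentOfOne`).
Ref: Arthur (1989), §4; Arthur (2013), §1.4, (1.4.9) ff. [cite: Arthur1989] -/
def sGroupAKer : Subgroup ψ.sGroupA :=
  Subgroup.connectedComponentOfOne ψ.sGroupA ⊔ L.centerFixed.subgroupOf ψ.sGroupA

/-- `S_ψ° · Z(Ĝ)^Γ` is normal in `S_ψ` (G19 `connectedComponentOfOne_normal`, the instance
`LGroupData.centerFixed_normal` with Mathlib `Subgroup.normal_subgroupOf`, and Mathlib
`Subgroup.sup_normal`).  Ref: Arthur (1989), §4. [cite: Arthur1989] -/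
instance sGroupAKer_normal : ψ.sGroupAKer.Normal :=
  Subgroup.sup_normal _ _

/-- Arthur's **component group** `𝒮_ψ = π₀(S_ψ / Z(Ĝ)^Γ) = S_ψ / S_ψ° Z(Ĝ)^Γ` (a quotient group,
Mathlib `QuotientGroup`).
Ref: Arthur (1989), §4; Arthur (2013), §1.4, (1.4.9) ff. [cite: Arthur1989] -/
def componentGroupA : Type :=
  ψ.sGroupA ⧸ ψ.sGroupAKer

/-- The group structure on `𝒮_ψ` (Mathlib `QuotientGroup.Quotient.group`, pinned explicitly to
keep instance search short).  Ref: Arthur (1989), §4. [cite: Arthur1989] -/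
instance instGroupComponentGroupA : Group ψ.componentGroupA :=
  QuotientGroup.Quotient.group ψ.sGroupAKer

/-- The projection `S_ψ → 𝒮_ψ` (Mathlib `QuotientGroup.mk'`).  Ref: Arthur (1989), §4. [cite: Arthur1989] -/
def toComponentGroupA : ψ.sGroupA →* ψ.componentGroupA :=
  QuotientGroup.mk' ψ.sGroupAKer

/-- `S_ψ → 𝒮_ψ` is surjective.  Ref: Arthur (1989), §4. [cite: Arthur1989] -/
theorem toComponentGroupA_surjective : Function.Surjective ψ.toComponentGroupA :=
  QuotientGroup.mk'_surjective _

/-- `θA(-1)` lies in `S_ψ`: `-1 = diag(-1, -1)` is central in `SL₂(ℂ)`, and `θA` commutes with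
`φ` and `θD`.  Ref: Arthur (1989), §4, (4.5); Arthur (2013), (1.4.10) ff. [cite: Arthur1989] -/
theorem θA_negOne_mem_sGroupA : ψ.θA (sl2Diag (-1)) ∈ ψ.sGroupA := by
  refine (ψ.mem_sGroupA_iff _).2 ⟨⟨fun w => (ψ.commute_φ_θA w _).symm, fun s => ?_⟩, fun s => ?_⟩
  · exact (ψ.commute_θ s _).symm
  · rw [← map_mul, ← map_mul]
    congr 1
    ext i j
    fin_cases i <;> fin_cases j <;> simp [Matrix.mul_apply, Fin.sum_univ_two]

/-- The lift `θA(diag(-1, -1)) ∈ S_ψ` of Arthur's `s_ψ`.  Ref: Arthur (1989), §4, (4.5). [cite: Arthur1989] -/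
def sPsiLift : ψ.sGroupA :=
  ⟨ψ.θA (sl2Diag (-1)), ψ.θA_negOne_mem_sGroupA⟩

/-- `(θA(-1))² = 1`.  Ref: Arthur (1989), §4. [cite: Arthur1989] -/
theorem sPsiLift_sq : ψ.sPsiLift ^ 2 = 1 := by
  have h : ((-1 : ℂˣ)) ^ 2 = 1 := by norm_num
  refine Subtype.ext ?_
  simp only [sPsiLift, SubmonoidClass.mk_pow, ← map_pow, h, map_one, OneMemClass.coe_one]

/-- Arthur's element `s_ψ ∈ 𝒮_ψ`: the image of `ψ(1, 1, -1) = θA(diag(-1, -1))`.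
Ref: Arthur (1989), §4, (4.5); Arthur (2013), §1.4 (after (1.4.10)). [cite: Arthur1989] -/
def sPsi : ψ.componentGroupA :=
  ψ.toComponentGroupA ψ.sPsiLift

/-- `s_ψ² = 1`.  Ref: Arthur (1989), §4. [cite: Arthur1989] -/
theorem sPsi_sq : ψ.sPsi ^ 2 = 1 := by
  rw [sPsi, ← map_pow, sPsiLift_sq, map_one]

end LocalAParameter

end Local

/-! ### Formal global parameters for `GL_N` (Arthur 2013, §1.4) -/

section Global

variable (K : Type) [Field K] [NumberField K]
  (hcpt : ∀ n : ℕ, isCompact_glFiniteIntegralLevel n K)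

/-- A **formal global parameter** for `GL_N` over the number field `K` (Arthur's substitute
for global A-parameters, which would need the hypothetical Langlands group): a finite formal
sum `ψ = ⊞_{i ∈ ι} μ_i ⊠ ν_{d_i}` where `μ_i` is a cuspidal automorphic representation of
`GL_{m_i}(𝔸_K)` (accepted `CuspidalAutomorphicRepData (m i) K (hcpt (m i))`, which threads the
I13 named fact `hcpt m : isCompact_glFiniteIntegralLevel m K` for every `m`; Arthur takes `μ_i`
unitary), `ν_d` is the irreducible `d`-dimensional representation of `SL₂(ℂ)`, and
`∑ m_i d_i = N`.
Ref: Arthur, *The endoscopic classification of representations* (2013), §1.3–1.4, (1.4.1);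
Mœglin–Waldspurger, Ann. Sci. ÉNS 22 (1989) (the discrete spectrum of `GL_N`). [folklore] -/
structure FormalGlobalParameterGL (N : ℕ) where
  /-- The finite index set of the simple summands `μ_i ⊠ ν_{d_i}`. -/
  ι : Type
  /-- `ι` is finite. -/
  [fintype : Fintype ι]
  /-- `μ_i` is a representation of `GL_{m i}`. -/
  m : ι → ℕ
  /-- The dimension `d_i` of the `SL₂(ℂ)`-factor `ν_{d_i}`. -/
  d : ι → ℕ
  /-- `m_i ≥ 1`. -/
  m_pos : ∀ i, 0 < m i
  /-- `d_i ≥ 1`. -/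
  d_pos : ∀ i, 0 < d i
  /-- The cuspidal automorphic representation `μ_i` of `GL_{m_i}(𝔸_K)`. -/
  cusp : ∀ i, CuspidalAutomorphicRepData (m i) K (hcpt (m i))
  /-- `∑ m_i d_i = N`. -/
  sum_eq : ∑ i, m i * d i = N

attribute [instance] FormalGlobalParameterGL.fintype

namespace FormalGlobalParameterGL

variable {K hcpt} {N : ℕ}

/-- The PREDICATE "`ψ = ⊞ μ_i ⊠ ν_{d_i}` is **multiplicity free**" (Arthur's condition `ℓ_k = 1`
cutting `Ψ_ell(N)`/`Ψ̃₂(G)` out of `Ψ(N)`, where (1.4.1) `ψ = ℓ₁ψ₁ ⊞ ⋯ ⊞ ℓ_rψ_r` allows arbitrary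
multiplicities `ℓ_k ≥ 1`): the simple parameters `μ_i ⊠ ν_{d_i}` are pairwise distinct, i.e. for
`i ≠ j` with `m_i = m_j` and `d_i = d_j` the cuspidal representations `μ_i`, `μ_j` of
`GL_{m_i}(𝔸_K)` are not nearly equivalent (equivalently, by strong multiplicity one, not
isomorphic; accepted `AutomorphicRepData.IsNearlyEquivalent`, transported along `m_i = m_j`).
A definition (a condition on `ψ`, consumed by `IsEllipticFor`), not an assertion: it fails for
`μ ⊞ μ` (`not_forall_isMultiplicityFree`); the argument `ψ` is an explicit binder so that the
declaration does not read as a closed named fact (fact audit 2026-08-15, module docstring).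
Ref: Arthur (2013), §1.4, (1.4.1) and the definition of `Ψ̃_ell(N)`; Mok (2015), (2.3.3);
Jacquet–Shalika 1981, §4. [cite: Arthur2013, §1.4 (1.4.1)] -/
def IsMultiplicityFree (ψ : FormalGlobalParameterGL K hcpt N) : Prop :=
  ∀ i j, i ≠ j → ∀ hm : ψ.m i = ψ.m j, ψ.d i = ψ.d j →
    ¬ AutomorphicRepData.IsNearlyEquivalent (hm ▸ ψ.cusp i).1 (ψ.cusp j).1

/-- `N ≥ 1` as soon as `ψ` has a summand (`m_i, d_i ≥ 1`).  Ref: Arthur (2013), (1.4.1). [cite: Arthur2013] -/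
theorem pos_of_nonempty (ψ : FormalGlobalParameterGL K hcpt N) [Nonempty ψ.ι] : 0 < N := by
  obtain ⟨i⟩ := ‹Nonempty ψ.ι›
  rw [← ψ.sum_eq]
  exact lt_of_lt_of_le (Nat.mul_pos (ψ.m_pos i) (ψ.d_pos i))
    (Finset.single_le_sum (f := fun j => ψ.m j * ψ.d j) (fun j _ => Nat.zero_le _)
      (Finset.mem_univ i))

/-- **`IsMultiplicityFree` is a condition, not a theorem**: multiplicity `ℓ₁ = 2` occurs in `Ψ(N)`.
For every cuspidal automorphic representation `μ` of `GL_n(𝔸_K)`, `n ≥ 1`, that is unramified at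
almost all finite places (the I15 named fact `AutomorphicRepData.hasSatakeParamAt_cofinite μ.1`,
Flath 1979, Thm. 3 — whence `μ` is nearly equivalent to itself), the formal parameter
`2(μ ⊠ ν₁) = μ ⊞ μ` of `GL_{2n}` (Arthur (1.4.1) with `r = 1`, `ℓ₁ = 2`; index set `Fin 2`) is not
multiplicity free, so `IsMultiplicityFree` does not hold for all parameters of `GL_{2n}`.
Ref: Arthur (2013), §1.4, (1.4.1) (`ψ = ℓ₁ψ₁ ⊞ ⋯ ⊞ ℓ_rψ_r`, `ℓ_k ≥ 1`) and the definition of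
`Ψ_ell(N)` (`ℓ_k = 1`); Mok, Mem. AMS 235 (2015), (2.3.3) and `Ψ̃_ell(N)` (arXiv:1206.0882,
pp. 10–11). [cite: Arthur2013, §1.4 (1.4.1)] -/
theorem not_forall_isMultiplicityFree {n : ℕ} (hn : 0 < n)
    (μ : CuspidalAutomorphicRepData n K (hcpt n)) (hμ : μ.1.hasSatakeParamAt_cofinite) :
    ¬ ∀ ψ : FormalGlobalParameterGL K hcpt (2 * n), ψ.IsMultiplicityFree := by
  intro h
  have hψ := h
    { ι := Fin 2, m := fun _ => n, d := fun _ => 1, m_pos := fun _ => hn,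
      d_pos := fun _ => Nat.one_pos, cusp := fun _ => μ, sum_eq := by simp }
  exact hψ (0 : Fin 2) 1 (show (0 : Fin 2) ≠ 1 by decide) rfl rfl
    (Filter.Eventually.mono hμ fun v ⟨α, hα⟩ => ⟨α, hα, hα⟩)

end FormalGlobalParameterGL

/-- **Hypothesis structure: self-duality types.** For every cuspidal automorphic representation
`μ` of `GL_m(𝔸_K)` a sign `sign μ ∈ {1, 0, -1}` (Mathlib `SignType`): `1` if `μ` is self-dual of
orthogonal type (`L(s, μ, Sym²)` has a pole at `s = 1`), `-1` if self-dual of symplectic type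
(`L(s, μ, Λ²)` has a pole at `s = 1`), `0` if `μ ≇ μ^∨`; exactly one case occurs for self-dual `μ`
(Arthur 2013, Thm. 1.4.1 / Thm. 1.5.3 (a)). The datum is a hypothesis: symmetric- and
exterior-square L-functions are not available in H21. `sign` is constant on near-equivalence
classes (`sign_eq`).
Ref: Arthur (2013), §1.4, Thm. 1.4.1; §1.5, Thm. 1.5.3. [cite: Arthur2013, Thm. 1.4.1 / Thm. 1.5.3 (a] -/
structure SelfDualTypeData where
  /-- The self-duality type of `μ`: `1` orthogonal, `-1` symplectic, `0` not self-dual. -/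
  sign : ∀ m : ℕ, CuspidalAutomorphicRepData m K (hcpt m) → SignType
  /-- The type only depends on the near-equivalence (= isomorphism) class of `μ`. -/
  sign_eq : ∀ (m : ℕ) (μ μ' : CuspidalAutomorphicRepData m K (hcpt m)),
    AutomorphicRepData.IsNearlyEquivalent μ.1 μ'.1 → sign m μ = sign m μ'

/-- **Hypothesis structure: Rankin–Selberg root numbers.** For cuspidal `μ` on `GL_m` and `μ'` on
`GL_{m'}` a sign `ε μ μ' ∈ ℤˣ = {±1}`: the global root number `ε(1/2, μ × μ')` of the
Rankin–Selberg L-function `L(s, μ × μ')` when `μ`, `μ'` are self-dual (then `ε(1/2) = ±1` by the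
functional equation `ε(s) ε(1 - s) = 1` for the self-dual pair); on non-self-dual pairs the
value is a **junk value, unconstrained by this structure** (intended `1`; self-duality lives in the
separate datum `SelfDualTypeData`, so an axiom `ε = 1` off self-dual pairs is not expressible
here, and only `epsCharacter`'s use is guarded, by `sd`). `ℤˣ`-valued so that sign characters
need no `ℂ → ℤˣ` conversion. Symmetric (`ε_symm`).
Ref: Arthur (2013), §1.5, Thm. 1.5.3 and (1.5.6)–(1.5.7); Jacquet–Piatetski-Shapiro–Shalika,
Amer. J. Math. 105 (1983). [cite: Arthur2013] -/
structure RSRootNumberData where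
  /-- `ε(1/2, μ × μ') ∈ {±1}` (unconstrained junk on non-self-dual pairs). -/
  ε : ∀ m m' : ℕ, CuspidalAutomorphicRepData m K (hcpt m) → CuspidalAutomorphicRepData m' K (hcpt m') → ℤˣ
  /-- `ε(1/2, μ × μ') = ε(1/2, μ' × μ)`. -/
  ε_symm : ∀ (m m' : ℕ) (μ : CuspidalAutomorphicRepData m K (hcpt m))
    (μ' : CuspidalAutomorphicRepData m' K (hcpt m')), ε m m' μ μ' = ε m' m μ' μ

/-- The three families of (quasi-)split classical groups of Arthur's book, indexed by the rank
`n`: `Sp(2n)`, `SO(2n+1)`, `SO(2n)` (the outer twist `η` of the quasi-split even orthogonal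
groups is not recorded in v0).
Ref: Arthur (2013), §1.2. [cite: Arthur2013] -/
inductive ClassicalType : Type
  /-- The symplectic group `Sp(2n)`; `Ĝ = SO(2n+1, ℂ)`. -/
  | symplectic (n : ℕ)
  /-- The split odd orthogonal group `SO(2n+1)`; `Ĝ = Sp(2n, ℂ)`. -/
  | oddOrthogonal (n : ℕ)
  /-- The (quasi-split) even orthogonal group `SO(2n)`; `Ĝ = SO(2n, ℂ)`. -/
  | evenOrthogonal (n : ℕ)
  deriving DecidableEq

namespace ClassicalType

/-- The degree `N` of the standard representation `Ĝ ↪ GL_N(ℂ)` (`G` is a twisted endoscopic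
group of `GL_N`): `2n+1` for `Sp(2n)`, `2n` for `SO(2n+1)` and `SO(2n)`.
Ref: Arthur (2013), §1.2. [cite: Arthur2013] -/
def dualDim : ClassicalType → ℕ
  | symplectic n => 2 * n + 1
  | oddOrthogonal n => 2 * n
  | evenOrthogonal n => 2 * n

/-- The type of the bilinear form on `ℂ^N` preserved by `Ĝ`: `1` (orthogonal) for `Sp(2n)` and
`SO(2n)` (`Ĝ = SO(2n+1, ℂ)`, `SO(2n, ℂ)`), `-1` (symplectic) for `SO(2n+1)` (`Ĝ = Sp(2n, ℂ)`).
Ref: Arthur (2013), §1.2, §1.4. [cite: Arthur2013] -/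
def dualSign : ClassicalType → SignType
  | symplectic _ => 1
  | oddOrthogonal _ => -1
  | evenOrthogonal _ => 1

/-- `dualSign` is never `0`.  Ref: Arthur (2013), §1.2. [cite: Arthur2013] -/
theorem dualSign_ne_zero (G : ClassicalType) : G.dualSign ≠ 0 := by
  cases G <;> simp [dualSign]

end ClassicalType

namespace FormalGlobalParameterGL

variable {K hcpt} {N : ℕ}

/-- `ψ ∈ Ψ̃₂(G)`: the formal parameter `ψ = ⊞ μ_i ⊠ ν_{d_i}` of `GL_N` is a **discrete (elliptic,
square-integrable) parameter for the classical group `G`**: `N = dualDim G`, `ψ` is multiplicity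
free, and every simple summand `μ_i ⊠ ν_{d_i}` is self-dual of the same type as `Ĝ`, i.e.
`sign(μ_i) · (-1)^{d_i - 1} = dualSign G` (`ν_d` is orthogonal for `d` odd, symplectic for `d`
even; written with `d_i + 1` to avoid `ℕ`-subtraction). Self-duality `sign(μ_i) ≠ 0` is implied
by the equation (`dualSign G ≠ 0`, `sign_ne_zero_of_isEllipticFor`). The central-character
condition (`∏ η_i^{d_i} = 1` for `Sp(2n)`, `= η_G` for `SO(2n)`) is not recorded in v0 (no
central characters of `CuspidalAutomorphicRepData` in H21); documented omission.
Ref: Arthur (2013), §1.4, definition of `Ψ̃₂(G)` before Thm. 1.4.1 and (1.4.8). [cite: Arthur2013] -/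
def IsEllipticFor (sd : SelfDualTypeData K hcpt) (G : ClassicalType)
    (ψ : FormalGlobalParameterGL K hcpt N) : Prop :=
  G.dualDim = N ∧ ψ.IsMultiplicityFree ∧
    ∀ i, sd.sign (ψ.m i) (ψ.cusp i) * (-1) ^ (ψ.d i + 1) = G.dualSign

/-- For `ψ ∈ Ψ̃₂(G)` every `μ_i` is self-dual (`sign μ_i ≠ 0`).  Ref: Arthur (2013), §1.4. [cite: Arthur2013] -/
theorem sign_ne_zero_of_isEllipticFor {sd : SelfDualTypeData K hcpt} {G : ClassicalType}
    {ψ : FormalGlobalParameterGL K hcpt N} (h : IsEllipticFor sd G ψ) (i : ψ.ι) :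
    sd.sign (ψ.m i) (ψ.cusp i) ≠ 0 := by
  intro h0
  have := h.2.2 i
  rw [h0, zero_mul] at this
  exact G.dualSign_ne_zero this.symm

end FormalGlobalParameterGL

variable {K hcpt} in
/-- The formal centralizer group `∏_{i ∈ ι} O(1) = (ℤˣ)^ι` of `ψ = ⊞_i ψ_i`: for `ψ ∈ Ψ̃₂(G)`,
`S_ψ` is (up to the determinant condition and identity components) `∏_i O(1)`, an element
`x = (x_i)` acting by the sign `x_i` on the summand `ψ_i` (Arthur 2013, (1.4.8)–(1.4.9)). An
`abbrev` for the Pi group.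
Ref: Arthur (2013), §1.4, (1.4.8). [cite: Arthur2013, (1.4.8] -/
abbrev sGroupFormal {N : ℕ} (ψ : FormalGlobalParameterGL K hcpt N) : Type :=
  ψ.ι → ℤˣ

/-- The homomorphism `ℤˣ → ℤˣ`, `1 ↦ 1`, `-1 ↦ e` (i.e. `u ↦ e^{(1-u)/2}`; a homomorphism since
`e² = 1` in `ℤˣ`, Mathlib `Int.units_mul_self`).  Ref: Arthur (2013), (1.5.6) (the factor
`det λ_α(s)` for a sign character `λ_α`). [cite: Arthur2013] -/
def unitsIntLift (e : ℤˣ) : ℤˣ →* ℤˣ where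
  toFun u := if u = 1 then 1 else e
  map_one' := if_pos rfl
  map_mul' u v := by
    rcases Int.units_eq_one_or u with rfl | rfl <;> rcases Int.units_eq_one_or v with rfl | rfl <;>
      simp [Int.units_mul_self, Units.ext_iff]

/-- `unitsIntLift e 1 = 1`.  Ref: Arthur (2013), (1.5.6). [cite: Arthur2013] -/
@[simp] theorem unitsIntLift_one (e : ℤˣ) : unitsIntLift e 1 = 1 := map_one _

/-- `unitsIntLift e (-1) = e`.  Ref: Arthur (2013), (1.5.6). [cite: Arthur2013] -/
@[simp] theorem unitsIntLift_neg_one (e : ℤˣ) : unitsIntLift e (-1) = e := by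
  change (if (-1 : ℤˣ) = 1 then 1 else e) = e
  exact if_neg (by decide)

variable {K hcpt}

/-- Arthur's **sign character** `ε_ψ : S_ψ → {±1}` of a formal parameter `ψ = ⊞_k μ_k ⊠ ν_{d_k}`,
transcribed from Arthur 2013 (1.5.6): `ε_ψ(x) = ∏'_α det(λ_α(s))`, the product over the
irreducible constituents `τ_α = λ_α ⊗ μ_α ⊗ ν_α` of the adjoint representation with `μ_α`
symplectic and `ε(1/2, μ_α) = -1`. For `x = (x_k) ∈ (ℤˣ)^ι` the constituents indexed by an
unordered pair `{k, l}`, `k ≠ l`, are `x ↦ x_k x_l` on `(μ_k × μ_l) ⊗ ν_{d_k} ⊗ ν_{d_l}`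
(`min(d_k, d_l)` of them), `μ_k × μ_l` being symplectic iff `μ_k`, `μ_l` have opposite types; the
diagonal constituents contribute `x_k² = 1`. Hence
`ε_ψ(x) = ∏_{k sympl., l orth., x_k x_l = -1} ε(1/2, μ_k × μ_l)^{min(d_k, d_l)}`, each opposite-type
pair being counted once at its symplectic member. Built as a product of homomorphisms
(`unitsIntLift`, `Pi.evalMonoidHom`), hence a genuine `MonoidHom`.
Ref: Arthur (2013), §1.5, (1.5.6)–(1.5.7); Arthur (1989), §8, (8.4). [cite: Arthur2013, (1.5.6] -/
def epsCharacter (sd : SelfDualTypeData K hcpt) (rn : RSRootNumberData K hcpt) {N : ℕ}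
    (ψ : FormalGlobalParameterGL K hcpt N) : sGroupFormal ψ →* ℤˣ :=
  ∏ k : ψ.ι, ∏ l : ψ.ι,
    if sd.sign (ψ.m k) (ψ.cusp k) = -1 ∧ sd.sign (ψ.m l) (ψ.cusp l) = 1 then
      (unitsIntLift (rn.ε (ψ.m k) (ψ.m l) (ψ.cusp k) (ψ.cusp l) ^ min (ψ.d k) (ψ.d l))).comp
        ((Pi.evalMonoidHom (fun _ => ℤˣ) k) * (Pi.evalMonoidHom (fun _ => ℤˣ) l))
    else 1

/-- Pointwise formula for `ε_ψ`.  Ref: Arthur (2013), (1.5.6). [cite: Arthur2013] -/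
theorem epsCharacter_apply (sd : SelfDualTypeData K hcpt) (rn : RSRootNumberData K hcpt) {N : ℕ}
    (ψ : FormalGlobalParameterGL K hcpt N) (x : sGroupFormal ψ) :
    epsCharacter sd rn ψ x = ∏ k : ψ.ι, ∏ l : ψ.ι,
      if sd.sign (ψ.m k) (ψ.cusp k) = -1 ∧ sd.sign (ψ.m l) (ψ.cusp l) = 1 then
        unitsIntLift (rn.ε (ψ.m k) (ψ.m l) (ψ.cusp k) (ψ.cusp l) ^ min (ψ.d k) (ψ.d l)) (x k * x l)
      else 1 := by
  simp only [epsCharacter, MonoidHom.finsetProd_apply]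
  refine Finset.prod_congr rfl fun k _ => Finset.prod_congr rfl fun l _ => ?_
  split_ifs <;> rfl

/-! ### Packets and the multiplicity formula (Arthur 1989, §8) -/

universe u v w

variable {𝒢 : AdelicGroupData.{u} K} {μ : Measure 𝒢.automorphicQuotient}
  [SMulInvariantMeasure 𝒢.Adelic 𝒢.automorphicQuotient μ]

variable (𝒢 μ) in
/-- **Hypothesis structure: Arthur packet data** for the adelic group datum `𝒢` and a type `Ψ`
of global parameters `ψ` with finite groups `S ψ` (the component groups `𝒮_ψ`): for each `ψ` a
global packet `packet ψ` (recorded through its members occurring as irreducible closed subspaces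
of `L²_disc`, G19 `DiscreteAutomorphicRep`), the pairing `⟨x, π⟩ = pairing ψ π x ∈ ℂ` (a class
function on `𝒮_ψ`, the character of the representation of `𝒮_ψ` attached to `π ∈ Π_ψ`; junk `0`
off the packet, `pairing_eq_zero`), Arthur's sign character `eps ψ = ε_ψ : 𝒮_ψ → {±1}`, and the
finiteness `finite_packets` of the set of `ψ` whose packet contains a given `π` (needed to write
`∑_ψ m_ψ(π)`). Nothing about the construction of packets (endoscopic character identities) is
asserted. Packets and pairings are indexed by *concrete* irreducible closed subspaces of
`L²_disc` (`DiscreteAutomorphicRep`), not by isomorphism classes, and no invariance under unitary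
equivalence is recorded (acceptable for this untagged hypothesis structure, OUTLINE D6).
Ref: Arthur, Astérisque 171–172 (1989), §8, Conj. 8.1; Arthur (2013), §1.5, Thm. 1.5.2. [cite: Arthur2013] -/
structure ArthurPacketData (Ψ : Type v) (S : Ψ → Type w) [∀ ψ, Group (S ψ)]
    [∀ ψ, Fintype (S ψ)] where
  /-- The (automorphic part of the) global packet `Π_ψ`. -/
  packet : Ψ → Set (DiscreteAutomorphicRep 𝒢 μ)
  /-- The pairing `⟨x, π⟩` on `𝒮_ψ × Π_ψ`. -/
  pairing : ∀ ψ, DiscreteAutomorphicRep 𝒢 μ → S ψ → ℂ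
  /-- Arthur's sign character `ε_ψ`. -/
  eps : ∀ ψ, S ψ →* ℤˣ
  /-- `⟨·, π⟩ = 0` for `π ∉ Π_ψ` (junk value, so that `m_ψ(π) = 0` off the packet). -/
  pairing_eq_zero : ∀ ψ π, π ∉ packet ψ → pairing ψ π = 0
  /-- `⟨·, π⟩` is a class function on `𝒮_ψ`. -/
  pairing_conj : ∀ ψ π (x y : S ψ), pairing ψ π (y * x * y⁻¹) = pairing ψ π x
  /-- Each `π` lies in only finitely many packets. -/
  finite_packets : ∀ π : DiscreteAutomorphicRep 𝒢 μ, {ψ | π ∈ packet ψ}.Finite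

variable {Ψ : Type v} {S : Ψ → Type w} [∀ ψ, Group (S ψ)] [∀ ψ, Fintype (S ψ)]

/-- Arthur's **expected multiplicity** `m_ψ(π) = |𝒮_ψ|⁻¹ ∑_{x ∈ 𝒮_ψ} ε_ψ(x) ⟨x, π⟩ ∈ ℂ` (a
non-negative integer when `⟨·, π⟩` is a character and `ε_ψ` a sign character: the multiplicity
of `ε_ψ` in `⟨·, π⟩`).
Ref: Arthur (1989), §8, (8.5) / Conj. 8.1; Arthur (2013), Thm. 1.5.2, (1.5.5). [cite: Arthur1989] -/
def arthurMultiplicity (data : ArthurPacketData 𝒢 μ Ψ S) (ψ : Ψ) (π : DiscreteAutomorphicRep 𝒢 μ) :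
    ℂ :=
  (Fintype.card (S ψ) : ℂ)⁻¹ * ∑ x : S ψ, ((data.eps ψ x : ℤ) : ℂ) * data.pairing ψ π x

/-- `m_ψ(π) = 0` for `π ∉ Π_ψ`.  Ref: Arthur (1989), §8. [cite: Arthur1989] -/
theorem arthurMultiplicity_eq_zero (data : ArthurPacketData 𝒢 μ Ψ S) {ψ : Ψ}
    {π : DiscreteAutomorphicRep 𝒢 μ} (h : π ∉ data.packet ψ) : arthurMultiplicity data ψ π = 0 := by
  simp [arthurMultiplicity, data.pairing_eq_zero ψ π h]

/-- **Arthur's multiplicity formula** for the packet data `data` (UNTAGGED statement, OUTLINE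
D6): every discrete automorphic representation `π ⊂ L²_disc(G(K) A_G \ G(𝔸_K))` occurs with finite
multiplicity `m` (G19 `ContRepresentation.multiplicity`, an `ℕ∞`, of `π` in the regular
representation `rightRegular 𝒢 μ`), and `m = ∑_{ψ : π ∈ Π_ψ} m_ψ(π)`; the `ℕ∞` is compared with
the complex sum through `∃ m : ℕ` (review 14).
Ref: Arthur, Astérisque 171–172 (1989), §8, Conj. 8.1; Arthur (2013), Thm. 1.5.2. [cite: Arthur2013] -/
def ArthurMultiplicityStatement (data : ArthurPacketData 𝒢 μ Ψ S) : Prop :=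
  ∀ π : DiscreteAutomorphicRep 𝒢 μ, ∃ m : ℕ,
    (𝒢.rightRegular μ).multiplicity π.space.toContRep = m ∧
      (m : ℂ) = ∑ ψ ∈ (data.finite_packets π).toFinset, arthurMultiplicity data ψ π

end Global

end Literature.NumberTheory.Automorphic
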